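import Summits.AtomisticToContinuum.BoseEinsteinCondensation.Theses.BECConjugateDomination

/-!
# Sketch (crux-ideate r2, ideator 5) — crux `BECConjugateDomination.InfraredMinimumUncertainty`
(stmt-AtomisticToContinuum-11784): first lemmas of the idea card `budget-sign-residue`

Units `ħ = 2m = 1`; torus of side `L`; `k = 2πm/L`; `N = n + 1` bosons; `Ψ > 0` the real positive
minimiser.  Three vectors of total momentum `−k` built from `Ψ`:

* demotion   `u₋ = a₀† a_m Ψ`,  `(u₋)(X) = L⁻³ ∑ⱼ ∫ conj e_m(y) Ψ(X | xⱼ ↦ y) dy`;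
* promotion  `u₊ = a†_{−m} a₀ Ψ`, `(u₊)(X) = L⁻³ ∑ⱼ conj e_m(xⱼ) ∫ Ψ(X | xⱼ ↦ y) dy`;
* density    `w  = ρ̄_m Ψ`,      `w(X) = ∑ₗ conj e_m(xₗ) Ψ(X)`  (`‖w‖² = N·S_m`, the crux's `S_m`).

`t₋ = Re⟨u₋, w⟩` (`demotionOverlap`), `t₊ = Re⟨u₊, w⟩` (`promotionOverlap`).  The **budget identity**
`t₊ − t₋ = n₀ − n_m` is the Pitaevskii–Stringari commutator `⟨[a₀†a_m, ρ_m]⟩ = n₀ − n_m` written in first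
quantisation (Fubini + the relabelling `xⱼ ↔ y`; needs `Ψ` real and `|e_m| = 1`) — provable now, typed here
as the Prop `BudgetIdentity` together with the two trivial bounds `0 ≤ n_m`, `n₀ ≤ N` the glue consumes.
The two stubs of the card are `DemotionSign` (`t₋ ≤ 0` on the window) and `PromotionResidueFloor`
(`N √((n_m+1) S_m) ≤ C · t₊` on the window); `occupationConjugateLaw_of_budget_sign_floor` is the
KERNEL-CHECKED composition `⇒ (n_m + 1)·S_m ≤ C²` (pure order arithmetic, `conj_product_le`).
-/

noncomputable section

open MeasureTheory Filter Set
open scoped ENNReal NNReal BigOperators ComplexConjugate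

namespace Summit.AtomisticToContinuum.BoseEinsteinCondensation.Cruxes.InfraredMinimumUncertainty.Sketch5

open Literature.MathematicalPhysics.QuantumManyBody.BoseGas
open Summit.AtomisticToContinuum.BoseEinsteinCondensation.Theses.BECConjugateDomination
  (InfraredMinimumUncertainty PuffFloor)

/-! ## Objects (all over `Config (n+1) → ℂ`, integrals on the fundamental cell) -/

/-- Wave vector `k = 2π m / L`. -/
def waveVec (L : ℝ) (m : Fin 3 → ℤ) : Space :=
  (2 * Real.pi / L) • latticeVec 1 m

/-- `n_m / N`: occupation fraction of the normalised plane wave `e_m/√(L³)` (`= ĉ_m(g)`). -/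
def occFrac (n : ℕ) (L : ℝ) (ψ : Config (n + 1) → ℂ) (m : Fin 3 → ℤ) : ℝ :=
  ∫ Y in cellN n L, ‖∫ x in cell L, starRingEnd ℂ (cellWave L m x) * ψ (Matrix.vecCons x Y)‖ ^ 2 / L ^ 3

/-- `n₀ / N = f`: condensate (constant-mode) fraction, `occFrac` at `m = 0` (`e₀ ≡ 1`). -/
def condFrac (n : ℕ) (L : ℝ) (ψ : Config (n + 1) → ℂ) : ℝ :=
  ∫ Y in cellN n L, ‖∫ x in cell L, ψ (Matrix.vecCons x Y)‖ ^ 2 / L ^ 3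

/-- The crux's structure factor `S_m = N⁻¹ ∫ |∑ⱼ e_m(xⱼ)|² |Ψ|²` (verbatim the crux's `let S`). -/
def structureFactor (n : ℕ) (L : ℝ) (ψ : Config (n + 1) → ℂ) (m : Fin 3 → ℤ) : ℝ :=
  ((n : ℝ) + 1)⁻¹ * ∫ X in cellN (n + 1) L, ‖∑ j : Fin (n + 1), cellWave L m (X j)‖ ^ 2 * ‖ψ X‖ ^ 2

/-- The density-wave factor `conj(ρ_m)(x, Y) = conj e_m(x) + ∑ₗ conj e_m(Yₗ)` of the configuration `x :: Y`. -/
def densityBar (n : ℕ) (L : ℝ) (m : Fin 3 → ℤ) (x : Space) (Y : Config n) : ℂ :=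
  starRingEnd ℂ (cellWave L m x) + ∑ l : Fin n, starRingEnd ℂ (cellWave L m (Y l))

/-- **Demotion–density overlap** `t₋ = Re⟨a₀†a_m Ψ, ρ̄_m Ψ⟩`
`= (N/L³) Re ∫_x ∫_Y [∫_y e_m(y) conj Ψ(y,Y)] · ρ̄_m(x,Y) · Ψ(x,Y)` (Bose symmetry collapses `∑ⱼ` to `N×` slot 0).
Second-quantised reading: `t₋ = ⟨n̂_m(n̂₀+1)⟩ + ⟨a†_m a†_{−m} a₀ a₀⟩ + R_m` (occupation + PAIR AMPLITUDE + 3-body rest). -/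
def demotionOverlap (n : ℕ) (L : ℝ) (ψ : Config (n + 1) → ℂ) (m : Fin 3 → ℤ) : ℝ :=
  ((n : ℝ) + 1) / L ^ 3 *
    (∫ x in cell L, ∫ Y in cellN n L,
      (∫ y in cell L, cellWave L m y * starRingEnd ℂ (ψ (Matrix.vecCons y Y))) *
        densityBar n L m x Y * ψ (Matrix.vecCons x Y)).re

/-- **Promotion–density overlap** `t₊ = Re⟨a†_{−m}a₀ Ψ, ρ̄_m Ψ⟩`
`= (N/L³) Re ∫_x ∫_Y [∫_y conj Ψ(y,Y)] · e_m(x) ρ̄_m(x,Y) · Ψ(x,Y)`.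
Second-quantised reading: `t₊ = ⟨n̂₀(n̂_{−m}+1)⟩ + ⟨a†_m a†_{−m} a₀ a₀⟩ + R₊`. -/
def promotionOverlap (n : ℕ) (L : ℝ) (ψ : Config (n + 1) → ℂ) (m : Fin 3 → ℤ) : ℝ :=
  ((n : ℝ) + 1) / L ^ 3 *
    (∫ x in cell L, ∫ Y in cellN n L,
      (∫ y in cell L, starRingEnd ℂ (ψ (Matrix.vecCons y Y))) *
        (cellWave L m x * densityBar n L m x Y * ψ (Matrix.vecCons x Y))).re

/-! ## The exact budget (provable now) -/

/-- **Budget identity** (first lemma of the line; PROVABLE NOW, size M): for every real periodic `C¹`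
state of `N = n+1` bosons and every `m`, `t₊ − t₋ = n₀ − n_m` — the commutator `⟨[a₀†a_m, ρ_m]⟩ = n̂₀ − n̂_m`
taken in `Ψ`; in first quantisation the `x ↔ y` cross terms of `t₊` and `t₋` coincide after relabelling
(reality of `Ψ`) and the diagonal terms are `n₀` (`|e_m|² = 1`) and `n_m`.  Packaged with the two order facts
the glue needs (`0 ≤ n_m`, Bessel `n₀ ≤ N`). No minimality, no positivity, any `L > 0`. -/
def BudgetIdentity : Prop :=
  ∀ (n : ℕ) (L : ℝ), 0 < L → ∀ Ψ : PeriodicTrialState (n + 1) L, (∀ X, Ψ.ψ X = (‖Ψ.ψ X‖ : ℂ)) →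
    ∀ m : Fin 3 → ℤ,
      promotionOverlap n L Ψ.ψ m - demotionOverlap n L Ψ.ψ m =
          ((n : ℝ) + 1) * condFrac n L Ψ.ψ - ((n : ℝ) + 1) * occFrac n L Ψ.ψ m ∧
      0 ≤ occFrac n L Ψ.ψ m ∧ condFrac n L Ψ.ψ ≤ 1

/-! ## Frame of the crux and the two stubs -/

/-- The smooth-class / positive-minimiser frame of the crux (verbatim hypotheses of
`InfraredMinimumUncertainty`), the potential and the constant passed to `P`. -/
def Frame (P : (ℝ → ℝ≥0∞) → ℝ → ∀ (ρ : ℝ) (n : ℕ),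
    PeriodicTrialState (n + 1) (sideLength ρ (n + 1)) → Prop) : Prop :=
  ∀ v : ℝ → ℝ≥0∞, IsRepulsiveFiniteRange v → (∀ r, v r ≠ ⊤) →
    ContDiff ℝ 2 (fun x : Space => (v ‖x‖).toReal) →
    (∃ Cₑ : ℝ, ∀ x : Space,
      ‖iteratedFDeriv ℝ 2 (fun x : Space => (v ‖x‖).toReal) x‖ ≤ Cₑ * Real.sqrt ((v ‖x‖).toReal)) →
    ∃ C : ℝ, 0 ≤ C ∧ ∃ ρ₀ : ℝ, 0 < ρ₀ ∧ ∀ ρ : ℝ, 0 < ρ → ρ < ρ₀ → ∀ᶠ n : ℕ in atTop,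
      ∀ Ψ : PeriodicTrialState (n + 1) (sideLength ρ (n + 1)),
        periodicEnergy v Ψ = periodicGroundStateEnergy v (n + 1) (sideLength ρ (n + 1)) →
        periodicEnergy v Ψ ≠ ⊤ → (∀ X, Ψ.ψ X = (‖Ψ.ψ X‖ : ℂ)) → (∀ X, Ψ.ψ X ≠ 0) → P v C ρ n Ψ

/-- **Stub Σ₋ — DemotionSign** (pair coherence out-weighs occupation; the minimality-carrying stub):
on the infrared window `‖k‖ ≤ K₀√ρ`, `t₋(m) ≤ 0`, i.e. `−⟨a†_m a†_{−m} a₀a₀⟩ ≥ ⟨n̂_m(n̂₀+1)⟩ + R_m`.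
Bogoliubov: `t₋ = −n₀ v_k(u_k − v_k) = −n₀ v/(u+v) < 0`, margin `→ n₀/2` as `k → 0`; `v ≡ 0`: `t₋ = 0`.
Windowed because the sign flips at UV modes where the dressed amplitude `A(k) < 0` (Born-zero phenomenon,
`TriageR1K2-LevyCorrectorBornZero`). FALSE for the free density-wave near-minimiser (`t₋ ≈ +2N²ε²`). -/
def DemotionSign (K₀ : ℝ) : Prop :=
  Frame fun _v _C ρ n Ψ => ∀ m : Fin 3 → ℤ, m ≠ 0 →
    ‖waveVec (sideLength ρ (n + 1)) m‖ ≤ K₀ * Real.sqrt ρ →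
      demotionOverlap n (sideLength ρ (n + 1)) Ψ.ψ m ≤ 0

/-- **Stub T₊ — PromotionResidueFloor** (one-phonon residue of the plane-wave promotion; Gavoret–Nozières
pole sharing in FLOOR form): on the window, `N·√((n_m + 1)·S_m) ≤ C · t₊(m)`.  By Cauchy–Schwarz always
`t₊ ≤ ‖u₊‖‖w‖ ≤ N√((n_m+1)S_m)`, so the stub says the inequality is saturated up to `C` (covariance
`⟨n̂₀ n̂_m⟩ ≳ N n_m/C²` folded in).  Bogoliubov: equality with `C = 1/f`; `v ≡ 0`: `t₊ = N = N√(1·1)`, `C = 1`;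
TRUE (with room) on the free density wave. -/
def PromotionResidueFloor (K₀ : ℝ) : Prop :=
  Frame fun _v C ρ n Ψ => ∀ m : Fin 3 → ℤ, m ≠ 0 →
    ‖waveVec (sideLength ρ (n + 1)) m‖ ≤ K₀ * Real.sqrt ρ →
      ((n : ℝ) + 1) * Real.sqrt ((((n : ℝ) + 1) * occFrac n (sideLength ρ (n + 1)) Ψ.ψ m + 1) *
          structureFactor n (sideLength ρ (n + 1)) Ψ.ψ m) ≤
        C * promotionOverlap n (sideLength ρ (n + 1)) Ψ.ψ m

/-- **Output on the window — OccupationConjugateLaw**: `(n_m + 1) · S_m ≤ C` for `‖k‖ ≤ K₀√ρ`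
(occupation form of the crux; the Lévy form follows by the log-series bridge once `f ≥ ½`). -/
def OccupationConjugateLawWindow (K₀ : ℝ) : Prop :=
  Frame fun _v C ρ n Ψ => ∀ m : Fin 3 → ℤ, m ≠ 0 →
    ‖waveVec (sideLength ρ (n + 1)) m‖ ≤ K₀ * Real.sqrt ρ →
      (((n : ℝ) + 1) * occFrac n (sideLength ρ (n + 1)) Ψ.ψ m + 1) *
          structureFactor n (sideLength ρ (n + 1)) Ψ.ψ m ≤ C

/-- **UV Lévy tail** (shared stub of every non-Fisher line; beyond the window): `N ν_m S_m ≤ C` for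
`‖k‖ > K₀√ρ`, with the crux's `g`, `ν`, `S` verbatim. -/
def UVLevyTail (K₀ : ℝ) : Prop :=
  Frame fun _v C ρ n Ψ => ∀ m : Fin 3 → ℤ, m ≠ 0 →
    (let L : ℝ := sideLength ρ (n + 1)
     let g : Space → ℝ := fun r => ∫ x in cell L, ∫ Y in cellN n L,
       ‖Ψ.ψ (Matrix.vecCons (x + r) Y)‖ * ‖Ψ.ψ (Matrix.vecCons x Y)‖
     let ν : ℝ := (cellFourierCoeff L (fun r : Space => ((Real.log (g r) : ℝ) : ℂ)) m).re
     K₀ * Real.sqrt ρ < ‖waveVec L m‖ → ((n : ℝ) + 1) * ν * structureFactor n L Ψ.ψ m ≤ C)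

/-! ## The composition: budget + sign + floor ⇒ an UPPER bound on the conjugate product -/

/-- Order arithmetic of the line: from the budget `tp − tm = n0 − nm`, the sign `tm ≤ 0`, the trivial
bounds `0 ≤ nm`, `n0 ≤ N`, and the floor `N·r ≤ C·tp`, conclude `r ≤ C`. -/
theorem conj_product_le {N n0 nm tp tm C r : ℝ} (hN : 0 < N) (hb : tp - tm = n0 - nm)
    (hm : tm ≤ 0) (hnm : 0 ≤ nm) (hn0 : n0 ≤ N) (hC : 0 ≤ C) (hf : N * r ≤ C * tp) : r ≤ C := by
  have htp : tp ≤ N := by linarith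
  have h1 : C * tp ≤ C * N := mul_le_mul_of_nonneg_left htp hC
  have h2 : N * r ≤ N * C := by linarith
  exact le_of_mul_le_mul_left h2 hN

/-- Squared form used by the glue: `r = √q`, `0 ≤ q` gives `q ≤ C²`. -/
theorem conj_product_sq_le {N n0 nm tp tm C q : ℝ} (hN : 0 < N) (hb : tp - tm = n0 - nm)
    (hm : tm ≤ 0) (hnm : 0 ≤ nm) (hn0 : n0 ≤ N) (hC : 0 ≤ C) (hq : 0 ≤ q)
    (hf : N * Real.sqrt q ≤ C * tp) : q ≤ C ^ 2 := by
  have hr : Real.sqrt q ≤ C := conj_product_le hN hb hm hnm hn0 hC hf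
  have h0 : 0 ≤ Real.sqrt q := Real.sqrt_nonneg q
  calc q = Real.sqrt q ^ 2 := (Real.sq_sqrt hq).symm
    _ ≤ C ^ 2 := by nlinarith

/-- **Glue of the line (KERNEL-CHECKED): budget + demotion sign + promotion floor ⇒ the occupation form of
the crux on the window**, with constant `C₊²`.  (The structure factor is manifestly `≥ 0`.) -/
theorem occupationConjugateLaw_of_budget_sign_floor (K₀ : ℝ) (hB : BudgetIdentity)
    (hS : DemotionSign K₀) (hT : PromotionResidueFloor K₀) : OccupationConjugateLawWindow K₀ := by
  intro v hv hfin hC2 hedge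
  obtain ⟨C₁, hC₁, ρ₁, hρ₁, h₁⟩ := hS v hv hfin hC2 hedge
  obtain ⟨C₂, hC₂, ρ₂, hρ₂, h₂⟩ := hT v hv hfin hC2 hedge
  refine ⟨C₂ ^ 2, by positivity, min ρ₁ ρ₂, lt_min hρ₁ hρ₂, ?_⟩
  intro ρ hρ hρlt
  have hρ1 : ρ < ρ₁ := lt_of_lt_of_le hρlt (min_le_left _ _)
  have hρ2 : ρ < ρ₂ := lt_of_lt_of_le hρlt (min_le_right _ _)
  filter_upwards [h₁ ρ hρ hρ1, h₂ ρ hρ hρ2] with n hn₁ hn₂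
  intro Ψ hE hEfin hreal hpos m hm hwin
  have hsign := hn₁ Ψ hE hEfin hreal hpos m hm hwin
  have hfloor := hn₂ Ψ hE hEfin hreal hpos m hm hwin
  have hL : 0 < sideLength ρ (n + 1) := by
    unfold sideLength
    apply Real.rpow_pos_of_pos
    positivity
  obtain ⟨hbud, hocc, hcond⟩ := hB n (sideLength ρ (n + 1)) hL Ψ hreal m
  have hN : (0 : ℝ) < (n : ℝ) + 1 := by positivity
  -- structure factor is nonnegative (integral of a nonnegative function w.r.t. the restricted measure)
  have hSnn : 0 ≤ structureFactor n (sideLength ρ (n + 1)) Ψ.ψ m := by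
    unfold structureFactor
    exact mul_nonneg (inv_nonneg.mpr hN.le) (integral_nonneg fun X => by positivity)
  have hnm : 0 ≤ ((n : ℝ) + 1) * occFrac n (sideLength ρ (n + 1)) Ψ.ψ m := mul_nonneg hN.le hocc
  have hq : 0 ≤ (((n : ℝ) + 1) * occFrac n (sideLength ρ (n + 1)) Ψ.ψ m + 1) *
      structureFactor n (sideLength ρ (n + 1)) Ψ.ψ m := mul_nonneg (by linarith) hSnn
  have hn0 : ((n : ℝ) + 1) * condFrac n (sideLength ρ (n + 1)) Ψ.ψ ≤ (n : ℝ) + 1 := by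
    have := mul_le_mul_of_nonneg_left hcond hN.le
    simpa using this
  exact conj_product_sq_le hN hbud hsign hnm hn0 hC₂ hq hfloor

end Summit.AtomisticToContinuum.BoseEinsteinCondensation.Cruxes.InfraredMinimumUncertainty.Sketch5
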